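import Literature.Algebra.Polynomial.CasasAlvero.DigitCriterion
import HarnessLib

/-!
# Casas-Alvero degrees in characteristic 11: everything except the digit `9`

By the digit criterion (`DigitCriterion.lean`) a Casas-Alvero degree in characteristic `11` is `0` or `a·11^k` with
`1 ≤ a ≤ 10`.  The digits `a = 1, 2, 3, 4` are Casas-Alvero degrees ([GrafVonBothmerEtAl2007, Props. 2, 6], de Jong–Draisma
for `a = 4` since `3·5·7 ≠ 0`), the digits `5, 6, 7` are not (prime-field counterexamples of this directory), and neither are
`8` (`binom(8,3) = 56 ≡ 1`) and `10` (`binom(10,2) = 45 ≡ 1`, the binomial `X^10 - X^2`).  The digit `9`,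
i.e. `CA_9` over fields of characteristic `11`, is the only case left undecided here.
-/

noncomputable section

open Polynomial

namespace Literature.Algebra.Polynomial.CasasAlvero

variable (K : Type*) [Field K] [CharP K 11]

/-- `CA_{4·11^k}` over every field of characteristic `11`. [cite: GrafVonBothmerEtAl2007, Prop. 6] -/
theorem holdsInDegree_four_mul_eleven_pow (k : ℕ) : HoldsInDegree K (4 * 11 ^ k) := by
  haveI : Fact (Nat.Prime 11) := ⟨by norm_num⟩
  exact holdsInDegree_mul_prime_pow_field K 11
    (holdsInDegree_of_le_four_of_charP (AlgebraicClosure K) 11 (by norm_num) le_rfl) k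

/-- `¬ CA_8` in characteristic `11`: `X^8 - X^3`, `binom(8,3) = 56 ≡ 1 (mod 11)`. [folklore] -/
theorem not_holdsInDegree_eight_of_char_eleven : ¬ HoldsInDegree K 8 :=
  not_holdsInDegree_of_choose_modEq_one K 11 (m := 3) (by norm_num) (by norm_num) (by decide)

/-- `¬ CA_10` in characteristic `11`: `X^10 - X^2`, `binom(10,2) = 45 ≡ 1 (mod 11)`. [folklore] -/
theorem not_holdsInDegree_ten_of_char_eleven : ¬ HoldsInDegree K 10 :=
  not_holdsInDegree_of_choose_modEq_one K 11 (m := 2) (by norm_num) (by norm_num) (by decide)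

/-- `¬ CA_{8·11^k}` in characteristic `11`. [folklore] -/
theorem not_holdsInDegree_eight_mul_eleven_pow (k : ℕ) : ¬ HoldsInDegree K (8 * 11 ^ k) := by
  haveI : Fact (Nat.Prime 11) := ⟨by norm_num⟩
  exact not_holdsInDegree_mul_prime_pow 11 k (not_holdsInDegree_eight_of_char_eleven K)

/-- `¬ CA_{10·11^k}` in characteristic `11`. [folklore] -/
theorem not_holdsInDegree_ten_mul_eleven_pow (k : ℕ) : ¬ HoldsInDegree K (10 * 11 ^ k) := by
  haveI : Fact (Nat.Prime 11) := ⟨by norm_num⟩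
  exact not_holdsInDegree_mul_prime_pow 11 k (not_holdsInDegree_ten_of_char_eleven K)

/-- **characteristic 11**: the Casas-Alvero degrees are among `{0} ∪ {1,2,3,4,9}·11^k`, and `{0} ∪ {1,2,3,4}·11^k` are
Casas-Alvero degrees; only the digit `9` is undecided. [cite: GrafVonBothmerEtAl2007, Props. 2, 6, 7]
[cite: CastryckLaterveerOunaies2012, §2] -/
theorem classification_char_eleven (d : ℕ) :
    (HoldsInDegree K d →
      d = 0 ∨ ∃ k, d = 11 ^ k ∨ d = 2 * 11 ^ k ∨ d = 3 * 11 ^ k ∨ d = 4 * 11 ^ k ∨ d = 9 * 11 ^ k) ∧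
    (d = 0 ∨ (∃ k, d = 11 ^ k ∨ d = 2 * 11 ^ k ∨ d = 3 * 11 ^ k ∨ d = 4 * 11 ^ k) → HoldsInDegree K d) := by
  haveI : Fact (Nat.Prime 11) := ⟨by norm_num⟩
  refine ⟨fun h => ?_, ?_⟩
  · by_contra hne
    push Not at hne
    obtain ⟨hd0, hne⟩ := hne
    by_cases h5 : ∃ k, d = 5 * 11 ^ k
    · obtain ⟨k, rfl⟩ := h5
      exact not_holdsInDegree_five_mul_prime_pow K 11 (by norm_num) k h
    by_cases h6 : ∃ k, d = 6 * 11 ^ k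
    · obtain ⟨k, rfl⟩ := h6
      exact not_holdsInDegree_six_mul_prime_pow K 11 (by norm_num) k h
    by_cases h7 : ∃ k, d = 7 * 11 ^ k
    · obtain ⟨k, rfl⟩ := h7
      exact not_holdsInDegree_seven_mul_prime_pow K 11 (by norm_num) (by norm_num) k h
    by_cases h8 : ∃ k, d = 8 * 11 ^ k
    · obtain ⟨k, rfl⟩ := h8
      exact not_holdsInDegree_eight_mul_eleven_pow K k h
    by_cases h10 : ∃ k, d = 10 * 11 ^ k
    · obtain ⟨k, rfl⟩ := h10
      exact not_holdsInDegree_ten_mul_eleven_pow K k h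
    push Not at h5 h6 h7 h8 h10
    refine not_holdsInDegree_of_not_digit K 11 hd0 (fun k a ha => ?_) h
    obtain ⟨h1, h2, h3, h4, h9⟩ := hne k
    interval_cases a
    · simpa using hd0
    · simpa using h1
    · exact h2
    · exact h3
    · exact h4
    · exact h5 k
    · exact h6 k
    · exact h7 k
    · exact h8 k
    · exact h9
    · exact h10 k
  · rintro (rfl | ⟨k, rfl | rfl | rfl | rfl⟩)
    · exact holdsInDegree_zero K
    · exact holdsInDegree_prime_pow_field K 11 k
    · exact holdsInDegree_two_mul_prime_pow_field K 11 k
    · exact holdsInDegree_three_mul_prime_pow_field K 11 (by norm_num) k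
    · exact holdsInDegree_four_mul_eleven_pow K k

end Literature.Algebra.Polynomial.CasasAlvero
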